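import Literature.NumberTheory.Rogawski1990.ArchExplicitTransferFactorEndoTorus   -- ★ LH3-p04 (g2) (I₁-Δ-S) PART 1: `map_evalC_fst∕snd_endoTorus`; brings the atlas PART 1∕2b and (W1-cont)'s place-wise `IsConj` kit
import Literature.NumberTheory.Automorphic.ArchTorusWeylAction                      -- ★ `monomial_conj_circleDiagonal`, `det_monomial_one_ne_zero` (Weyl relabelling realised in `GL₃(ℂ)`)
import HarnessLib

/-!
# (I₁-Δ-S) PART 2a: `endoTorus S c ↔ gprimeTorus α S (c∘ρ)` IS A NORM PAIR — the atlas charts of `H_∞` and `G′_∞` match place by place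
# (Rogawski 1990 §3.6 p. 31, §4.8 p. 53, §8.2 p. 122; Knapp 1986 Ch. V §3; Shelstad 1979 §4)

Topic `NumberTheory/Rogawski1990`; namespace `Literature.NumberTheory.Rogawski1990`.  THEOREMS ONLY (no `def`, no instance, no notation, no axiom, no named fact, no `sorry`).
Cell `pub/hodgecm-mathlib`, line LH3 (closer stub `stub_N9`, crux H413 = `stmt-HodgeConjecture-24833`), DIRECT ROAD organ **(I₁-Δ-S)** PART 2a (LH3-plan (g2) D2′-SPEC §3b:
`δ_ρ(c) := Δ″(endoTorus S c, gprimeTorus S (ρ c))` presupposes that the two atlas charts ★ p849525 (`endoTorus`, LH3-p03) and ★ PART 2b (`gprimeTorus`, LH3-p03) are NORM PAIRS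
— `IsArchNormPair`, the guard of ★ `archExplicitDelta`).  HOUSE FRAME `H′ = diagonal α`; `S` a set of split-chart places (`S ⊆ splitChartPlaces L α`); the relabelling `ρ : W → S₃`
acts on the coordinates of the COMPACT places only (`ρ_w = 1` on `S`: a split place has one partner class).

THE MATHEMATICS (place by place, then ★ `isConj_of_forall_isConj_map_evalC`).  At `w ∉ S`: `ι(P·diag(e^{ic₀}, e^{ic₂})·P⁻¹, e^{ic₁}) ∼ diag(e^{ic₀}, e^{ic₁}, e^{ic₂})`
(★ `isConj_endoGL_cayley_conj_circleDiagonal`) `∼` the compact chart `gprimeCptGL τ (c_w ∘ ρ_w) = diag(ℓ ↦ e^{i c_w(ρ_w(τ⁻¹ ℓ))})` by the Weyl relabelling `τ⁻¹·ρ_w` realised in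
`GL₃(ℂ)` (★ `monomial_conj_circleDiagonal`).  At `w ∈ S`: `ι(diag(e^{x+iθ}, e^{−x+iθ}), e^{iφ}) = diag(boostEig (c w))` LITERALLY (the endoscopic pattern puts the 2-block on
`{e₀, e₂}`), and the split chart is `P_τ · cayB · diag(boostEig (c w)) · cayB⁻¹ · P_τ⁻¹` (★ `boostStd_eq_conj_diagonal`, re-indexed by the slot-to-line map `τ = lineOf s`:
`P_τ M P_τ⁻¹ = M.submatrix τ⁻¹ τ⁻¹`, `monomial_one_mul_eq_submatrix_mul`).

WHAT IS PROVED.  `monomial_one_mul_eq_submatrix_mul`, `isConj_of_coe_eq_submatrix` (re-indexing is conjugation in `GL₃(ℂ)`); `map_evalC_gprimeTorus`,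
`map_evalC_endoEmbArch_endoTorus` (place components); `coe_endoBlock_eq_cayley_of_not_mem`, `coe_endoBlock_eq_hypBlockGL_of_mem`, `coe_endoGL_hypBlockGL` (`= diag(boostEig)`);
`isConj_endoGL_endoBlock_gprimeCptGL` (compact place, any `ρ_w`), `isConj_endoGL_endoBlock_gprimeSplitGL` (split place); **`isArchNormPair_endoTorus_gprimeTorus`**.
HONEST LABEL: HC_CM is proved only modulo the 7 printed citations (2 remaining: hLiu418 = stmt-HodgeConjecture-24832, h413 = stmt-HodgeConjecture-24833) until rung 0 closes; kit for
(I₁-Δ-S) PART 2b (`κ_w` of the chart partners and `Δ″` on the atlas), pays nothing by itself.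

## References
* [Rogawski1990] J. D. Rogawski, *Automorphic Representations of Unitary Groups in Three Variables*, Ann. of Math. Stud. 123 (1990), §3.6 p. 31, §4.8 p. 53, §8.2 p. 122.
* [Knapp1986] A. W. Knapp, *Representation Theory of Semisimple Groups* (1986), Ch. V §3.
* [Shelstad1979] D. Shelstad, *Characters and inner forms of a quasi-split group over ℝ*, Compositio Math. 39 (1979), §4 pp. 22–25.
-/

set_option autoImplicit false

noncomputable section

open NumberField NumberField.InfinitePlace Complex Equiv
open scoped MatrixGroups ComplexConjugate Classical
open Literature.NumberTheory.Automorphic Literature.NumberTheory.Automorphic.UnitaryGroup Literature.NumberTheory.GaloisRepresentations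
open Literature.LinearAlgebra.Matrix

namespace Literature.NumberTheory.Rogawski1990

/-! ## §1 Re-indexing is conjugation by a permutation matrix -/

/-- `M(σ, 1) · A = A.submatrix σ⁻¹ σ⁻¹ · M(σ, 1)`: left multiplication by the permutation matrix of `σ` re-indexes. [cite: BrockerTomDieck1985, IV (3.2) (p0161)] [cite: Knapp1986, Ch. V §3] -/
theorem monomial_one_mul_eq_submatrix_mul (σ : Perm (Fin 3)) (A : Matrix (Fin 3) (Fin 3) ℂ) :
    monomial σ (fun _ => (1 : ℂ)) * A = A.submatrix ⇑σ.symm ⇑σ.symm * monomial σ (fun _ => (1 : ℂ)) := by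
  ext i j
  simp only [Matrix.mul_apply, monomial_apply, Matrix.submatrix_apply]
  rw [Finset.sum_eq_single (σ.symm i) (fun k _ hk => by rw [if_neg (fun h => hk (by rw [h, Equiv.symm_apply_apply])), zero_mul])
      (fun h => absurd (Finset.mem_univ _) h),
    Finset.sum_eq_single (σ j) (fun k _ hk => by rw [if_neg hk, mul_zero]) (fun h => absurd (Finset.mem_univ _) h)]
  simp

/-- **Re-indexing is conjugation in `GL₃(ℂ)`**: if `↑h = (↑g).submatrix σ⁻¹ σ⁻¹` then `g` and `h` are conjugate (by the permutation matrix of `σ`; the Weyl group of the diagonal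
torus realised by monomial matrices). [cite: BrockerTomDieck1985, IV (3.2) (p0161)] [cite: Rogawski1990, §3.1 p. 19] -/
theorem isConj_of_coe_eq_submatrix (σ : Perm (Fin 3)) (g h : GL (Fin 3) ℂ)
    (hgh : (h : Matrix (Fin 3) (Fin 3) ℂ) = (g : Matrix (Fin 3) (Fin 3) ℂ).submatrix ⇑σ.symm ⇑σ.symm) : IsConj g h := by
  refine isConj_iff.2 ⟨Matrix.GeneralLinearGroup.mkOfDetNeZero _ (det_monomial_one_ne_zero 3 σ), ?_⟩
  rw [mul_inv_eq_iff_eq_mul]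
  apply Units.ext
  simp only [Units.val_mul, Matrix.GeneralLinearGroup.val_mkOfDetNeZero, hgh]
  exact monomial_one_mul_eq_submatrix_mul σ _

section Atlas

variable (L : Type) [Field L] [NumberField L] [IsCMField L] (α : Fin 3 → L)
  (S : Finset {w : InfinitePlace L // IsComplex w}) (c : {w : InfinitePlace L // IsComplex w} → Fin 3 → ℝ) (w : {w : InfinitePlace L // IsComplex w})

/-! ## §2 Place components -/

/-- The `w`-component of `gprimeTorus α S c` is the atlas block `gprimeBlock α w S c`. [cite: Rogawski1990, §3.6 p. 31] -/
theorem map_evalC_gprimeTorus :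
    Matrix.GeneralLinearGroup.map (UnitaryGroup.evalC L w)
        ((gprimeTorus L α S c : ↥(UnitaryGroup.arch (↥(maximalRealSubfield L)) L (IsCMField.complexConj L) 3 (Matrix.diagonal α))) : GL (Fin 3) (mixedEmbedding.mixedSpace L)) =
      ((gprimeBlock L α w S c : ↥(archLocal L 3 (Matrix.diagonal α) w)) : GL (Fin 3) ℂ) := by
  change (((UnitaryGroup.archPiEquivCM 3 L (Matrix.diagonal α)) (gprimeTorus L α S c) w : ↥(UnitaryGroup.archLocal L 3 (Matrix.diagonal α) w)) : GL (Fin 3) ℂ) = _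
  rw [archPiEquivCM_gprimeTorus]

/-- The `w`-component of `ι_∞(endoTorus S c)` is `ι(endoBlock S c w, endoCircle c w)`. [cite: Rogawski1990, §4.8 p. 53; §8.2 p. 122] -/
theorem map_evalC_endoEmbArch_endoTorus :
    Matrix.GeneralLinearGroup.map (UnitaryGroup.evalC L w) ((endoEmbArch L (endoTorus L S c)).val : GL (Fin 3) (mixedEmbedding.mixedSpace L)) =
      endoGL (((endoBlock L S c w : ↥(archLocal L 2 (Matrix.of fun i j : Fin 2 => if i.val + j.val + 1 = 2 then (1 : L) else 0) w)) : GL (Fin 2) ℂ),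
        ((endoCircle L c w : ↥(archLocal L 1 (Matrix.of fun i j : Fin 1 => if i.val + j.val + 1 = 1 then (1 : L) else 0) w)) : GL (Fin 1) ℂ)) := by
  rw [coe_endoEmbArch, map_endoGL, map_evalC_fst_endoTorus L S c w, map_evalC_snd_endoTorus L S c w]

variable {S w} in
omit [NumberField L] [IsCMField L] in
/-- At `w ∉ S` the block IS the Cayley-frame circle block (as a `GL₂(ℂ)` element). [cite: Rogawski1990, §8.2 p. 122] -/
theorem coe_endoBlock_eq_cayley_of_not_mem (hw : w ∉ S) :
    ((endoBlock L S c w : ↥(archLocal L 2 (Matrix.of fun i j : Fin 2 => if i.val + j.val + 1 = 2 then (1 : L) else 0) w)) : GL (Fin 2) ℂ) =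
      Matrix.GeneralLinearGroup.mkOfDetNeZero !![(1 : ℂ), 1; 1, -1] det_cayleyTwo_ne_zero * circleDiagonal 2 ![Circle.exp (c w 0), Circle.exp (c w 2)] *
        (Matrix.GeneralLinearGroup.mkOfDetNeZero !![(1 : ℂ), 1; 1, -1] det_cayleyTwo_ne_zero)⁻¹ := by
  unfold endoBlock
  rw [if_neg hw]

variable {S w} in
omit [NumberField L] [IsCMField L] in
/-- At `w ∈ S` the block IS the hyperbolic block `hypBlockGL x θ` (as a `GL₂(ℂ)` element). [cite: Rogawski1990, §3.6 p. 31] -/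
theorem coe_endoBlock_eq_hypBlockGL_of_mem (hw : w ∈ S) :
    ((endoBlock L S c w : ↥(archLocal L 2 (Matrix.of fun i j : Fin 2 => if i.val + j.val + 1 = 2 then (1 : L) else 0) w)) : GL (Fin 2) ℂ) = hypBlockGL (c w 0) (c w 2) := by
  unfold endoBlock
  rw [if_pos hw]

/-- `det diag(boostEig c) ≠ 0`. [cite: Knapp1986, Ch. V §3] -/
theorem det_diagonal_boostEig_ne_zero (cw : Fin 3 → ℝ) : (Matrix.diagonal (boostEig cw)).det ≠ 0 := by
  rw [Matrix.det_diagonal]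
  exact Finset.prod_ne_zero_iff.2 fun i _ => by fin_cases i <;> simp [boostEig, Complex.exp_ne_zero]

/-- **`ι(diag(e^{x+iθ}, e^{−x+iθ}), e^{iφ}) = diag(boostEig (x, φ, θ))`**: the endoscopic pattern puts the 2-block on `{e₀, e₂}` and the 1-block on `e₁` — the slot order of
★ `boostEig`. [cite: Rogawski1990, §4.8 p. 53] [cite: Knapp1986, Ch. V §3] -/
theorem coe_endoGL_hypBlockGL (cw : Fin 3 → ℝ) :
    ((endoGL (hypBlockGL (cw 0) (cw 2), circleDiagonal 1 ![Circle.exp (cw 1)]) : GL (Fin 3) ℂ) : Matrix (Fin 3) (Fin 3) ℂ) = Matrix.diagonal (boostEig cw) := by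
  rw [coe_endoGL_eq, coe_hypBlockGL, coe_circleDiagonal]
  ext i j
  fin_cases i <;> fin_cases j <;> simp [boostEig, Matrix.diagonal, Circle.coe_exp]

/-! ## §3 Place-wise conjugacy of the two charts -/

variable {S w} in
omit [NumberField L] [IsCMField L] in
/-- **COMPACT PLACE**: `ι(endoBlock S c w, endoCircle c w) ∼ gprimeCptGL τ (c_w ∘ ρ_w)` in `GL₃(ℂ)` for EVERY slot-to-line map `τ` and every relabelling `ρ_w` (Cayley block `∼`
diagonal, then the Weyl relabelling `ℓ ↦ ρ_w(τ⁻¹ ℓ)` realised by a permutation matrix). [cite: Rogawski1990, §8.2 p. 122; §3.1 p. 19] -/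
theorem isConj_endoGL_endoBlock_gprimeCptGL (hw : w ∉ S) (τ ρw : Perm (Fin 3)) :
    IsConj (endoGL (((endoBlock L S c w : ↥(archLocal L 2 (Matrix.of fun i j : Fin 2 => if i.val + j.val + 1 = 2 then (1 : L) else 0) w)) : GL (Fin 2) ℂ),
        ((endoCircle L c w : ↥(archLocal L 1 (Matrix.of fun i j : Fin 1 => if i.val + j.val + 1 = 1 then (1 : L) else 0) w)) : GL (Fin 1) ℂ)))
      (gprimeCptGL τ (c w ∘ ⇑ρw)) := by
  rw [coe_endoBlock_eq_cayley_of_not_mem L c hw]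
  have h1 := isConj_endoGL_cayley_conj_circleDiagonal (Circle.exp (c w 0)) (Circle.exp (c w 2)) (Circle.exp (c w 1))
  have h2 : IsConj (circleDiagonal 3 ![Circle.exp (c w 0), Circle.exp (c w 1), Circle.exp (c w 2)]) (gprimeCptGL τ (c w ∘ ⇑ρw)) := by
    refine isConj_iff.2 ⟨Matrix.GeneralLinearGroup.mkOfDetNeZero _ (det_monomial_one_ne_zero 3 (τ.symm.trans ρw).symm), ?_⟩
    rw [monomial_conj_circleDiagonal]
    unfold gprimeCptGL
    congr 1
    funext ℓ
    simp only [Equiv.symm_symm, Equiv.trans_apply, Function.comp_apply]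
    generalize ρw (τ.symm ℓ) = k
    fin_cases k <;> rfl
  exact h1.trans h2

variable {w} in
/-- **SPLIT PLACE**: `diag(boostEig (c w)) ∼ gprimeSplitGL τ a (c w)` in `GL₃(ℂ)` when the boost plane is hyperbolic (`a (τ 0) · a (τ 2) < 0`): conjugator `P_τ · cayB(a∘τ)`
(★ `boostStd_eq_conj_diagonal`, then re-indexing §1). [cite: Knapp1986, Ch. V §3] [cite: Rogawski1990, §3.6 p. 31] -/
theorem isConj_diagonal_boostEig_gprimeSplitGL (τ : Perm (Fin 3)) (a : Fin 3 → ℝ) (h : a (τ 0) * a (τ 2) < 0) (cw : Fin 3 → ℝ) :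
    IsConj (Matrix.GeneralLinearGroup.mkOfDetNeZero (Matrix.diagonal (boostEig cw)) (det_diagonal_boostEig_ne_zero cw)) (gprimeSplitGL τ a cw) := by
  have hb : (a ∘ ⇑τ) 0 * (a ∘ ⇑τ) 2 < 0 := h
  -- step 1: `diag(boostEig) ∼ boostStd (a∘τ) cw` by `cayB`
  have h1 : IsConj (Matrix.GeneralLinearGroup.mkOfDetNeZero (Matrix.diagonal (boostEig cw)) (det_diagonal_boostEig_ne_zero cw))
      (Matrix.GeneralLinearGroup.mkOfDetNeZero (boostStd (a ∘ ⇑τ) cw) (det_boostStd_ne_zero _ _)) := by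
    refine isConj_iff.2 ⟨Matrix.GeneralLinearGroup.mkOfDetNeZero _ (det_cayB_ne_zero hb), ?_⟩
    apply Units.ext
    rw [Units.val_mul, Units.val_mul, Matrix.coe_units_inv]
    simp only [Matrix.GeneralLinearGroup.val_mkOfDetNeZero]
    exact (boostStd_eq_conj_diagonal hb cw).symm
  -- step 2: `boostStd ∼ its re-indexing = gprimeSplitMatrix`
  have h2 : IsConj (Matrix.GeneralLinearGroup.mkOfDetNeZero (boostStd (a ∘ ⇑τ) cw) (det_boostStd_ne_zero _ _)) (gprimeSplitGL τ a cw) :=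
    isConj_of_coe_eq_submatrix τ _ _ (by rw [coe_gprimeSplitGL, Matrix.GeneralLinearGroup.val_mkOfDetNeZero]; rfl)
  exact h1.trans h2

variable {S w} in
omit [NumberField L] [IsCMField L] in
/-- **SPLIT PLACE, the charts**: `ι(endoBlock S c w, endoCircle c w) ∼ gprimeBlock α w S c` at `w ∈ S ∩ splitChartPlaces`. [cite: Rogawski1990, §3.6 p. 31] [cite: Knapp1986, Ch. V §3] -/
theorem isConj_endoGL_endoBlock_gprimeBlock_of_mem (hw : w ∈ S) (hsp : w ∈ splitChartPlaces L α) :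
    IsConj (endoGL (((endoBlock L S c w : ↥(archLocal L 2 (Matrix.of fun i j : Fin 2 => if i.val + j.val + 1 = 2 then (1 : L) else 0) w)) : GL (Fin 2) ℂ),
        ((endoCircle L c w : ↥(archLocal L 1 (Matrix.of fun i j : Fin 1 => if i.val + j.val + 1 = 1 then (1 : L) else 0) w)) : GL (Fin 1) ℂ)))
      ((gprimeBlock L α w S c : ↥(archLocal L 3 (Matrix.diagonal α) w)) : GL (Fin 3) ℂ) := by
  rw [coe_gprimeBlock_of_mem L α c hw hsp, coe_endoBlock_eq_hypBlockGL_of_mem L c hw]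
  have hD : endoGL (hypBlockGL (c w 0) (c w 2), ((endoCircle L c w : ↥(archLocal L 1 (Matrix.of fun i j : Fin 1 => if i.val + j.val + 1 = 1 then (1 : L) else 0) w)) : GL (Fin 1) ℂ)) =
      Matrix.GeneralLinearGroup.mkOfDetNeZero (Matrix.diagonal (boostEig (c w))) (det_diagonal_boostEig_ne_zero (c w)) := by
    apply Units.ext
    rw [Matrix.GeneralLinearGroup.val_mkOfDetNeZero]
    exact coe_endoGL_hypBlockGL (c w)
  rw [hD]
  exact isConj_diagonal_boostEig_gprimeSplitGL (lineOf (formSign L α w)) (formRe L α w) hsp.2 (c w)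

/-! ## §4 The norm pair -/

/-- **`endoTorus S c ↔ gprimeTorus α S (c ∘ ρ)` IS A NORM PAIR** for every Cartan class `S ⊆ splitChartPlaces`, all coordinates `c`, and every relabelling `ρ : W → S₃` of the
compact places (`ρ_w = 1` on `S`): `ι_∞(endoTorus S c)` and `gprimeTorus α S (w ↦ c_w ∘ ρ_w)` are conjugate in `GL₃(L ⊗ ℝ)` (place by place §3, ★ `isConj_of_forall_isConj_map_evalC`).
[cite: Rogawski1990, §3.6 p. 31; §4.8 p. 53; §8.2 p. 122] [cite: Shelstad1979, §4] -/
theorem isArchNormPair_endoTorus_gprimeTorus (hS : ∀ w ∈ S, w ∈ splitChartPlaces L α)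
    (ρ : {w : InfinitePlace L // IsComplex w} → Perm (Fin 3)) (hρ : ∀ w ∈ S, ρ w = 1) :
    IsArchNormPair L (Matrix.diagonal α) (endoTorus L S c) (gprimeTorus L α S fun w => c w ∘ ⇑(ρ w)) := by
  rw [isArchNormPair_iff]
  unfold Corresponds
  refine UnitaryGroup.isConj_of_forall_isConj_map_evalC L fun w => ?_
  rw [map_evalC_endoEmbArch_endoTorus L S c w, map_evalC_gprimeTorus L α S _ w]
  by_cases hw : w ∈ S
  · have hc : (fun v => c v ∘ ⇑(ρ v)) w = c w := by simp only [hρ w hw, Equiv.Perm.coe_one, Function.comp_id]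
    rw [show gprimeBlock L α w S (fun v => c v ∘ ⇑(ρ v)) = gprimeBlock L α w S c from by
      unfold gprimeBlock; simp only [hc]]
    exact isConj_endoGL_endoBlock_gprimeBlock_of_mem L α c hw (hS w hw)
  · rw [coe_gprimeBlock_of_not_mem L α _ hw]
    exact isConj_endoGL_endoBlock_gprimeCptGL L c hw (lineOf (formSign L α w)) (ρ w)

end Atlas

end Literature.NumberTheory.Rogawski1990

end
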